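/-
Copyright (c) 2026 the pub-hodgecm-mathlib formalisation cell (harness21).  Prover seat hodgecm-mathlib-F0P2-p07 (g0), strike line L1
`stub_firstTermThetaPairing` (LEAD F0P6-plan (g14) BATCH #68: «F0P2-p07 = non-split evaluation»; the phase dictionary it needs): Track B «K2-LIT»,
hLiu418 = stmt-HodgeConjecture-24832, road `K2_Liu`, socket #42S, organ S1 ROAD W, (G) organ (ρ-mid): THE LOCAL TRACE AT A NON-SPLIT PLACE AND THE PHASE `Ψ_s`.
-/
import Literature.NumberTheory.Automorphic.QuadraticLocalBaseChange                 -- ★ `quadraticLocalEquiv`, `conjLocal_quadraticLocalEquiv`, `toPlace`, `toLocalRing`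
import Literature.NumberTheory.Automorphic.AnisotropicUnitaryGroupCompactOfPlace       -- ★ `conjLocal_apply_eq_of_smul_eq` (one place above a non-split `v`)
import Literature.NumberTheory.Automorphic.UnitaryGroupNonsplitPlace                   -- ★ `PlacesOver.subsingleton_of_smul_eq`
import Mathlib.Analysis.SpecialFunctions.Complex.Circle
import HarnessLib

/-!
# Crux `HLiu418`, #42S organ S1, (G) organ (ρ-mid): THE LOCAL TRACE `τ : E_{w₀} → F_v` AT A NON-SPLIT PLACE AND THE PHASE `Ψ_s = ψ_v(s · τ(·))`

Cell `hodgecm-mathlib`, crux item hLiu418 = `stmt-HodgeConjecture-24832`; squad K2 ∕ K2Liu; LEAD F0P6-plan (g14); (M2a) chain: K2Liu-p26 (g2) (C3) head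
`K2LiuTensorMiddleCellLeviRow`, K2E1-p10 (g4) (C3-c) frame reading, K2Liu-p23 (g2) (C3-b), F0P2-p07 (g0) the non-split evaluation 📤 `K2LiuNonsplitMiddleProfileRow`.
THEOREMS ONLY (no `def`, no instance, no notation, no named-fact hypothesis, no `sorry`); lane `--supports stmt-HodgeConjecture-24832 --as helper`.

WHY.  ★ (M2b) `factorisation_of_middleProfile_balls` and ★ (R-c) `setIntegral_middleProfile_eq_ite` integrate a CHARACTER OF THE FIELD `K = E_{w₀}` against
`α·σβ + D·γ·σγ`; the (C3) Levi row hands the phase as `ψ_v` OF AN `F_v`-VALUED hermitian expression `q` with `ι_{w₀}(q) = ασβ + βσα + 2D·γσγ = Z + σZ`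
(`Z = ασβ + D·γσγ`).  The bridge is the LOCAL TRACE `τ : E_{w₀} →+ F_v`, `ι_{w₀}(τ Z) = Z + σ_{w₀} Z` (at a non-split `v` the fixed field of `σ_{w₀}` on `E_{w₀}` is
`ι_{w₀}(F_v)`): `ψ_v(s·q) = (ψ_v ∘ (s·τ))(Z)`.  THIS FILE (generic quadratic `E/F`, `c` with `c δ = −δ ≠ 0`, a place `w₀ ∣ v` with `c • w₀ = w₀`):
* §1 **`exists_localTrace`** — `∃ τ : E_{w₀} →+ F_v`, continuous, `ι_{w₀}(τ z) = z + σ_{w₀} z`, `F_v`-linear `τ(ι_{w₀}(r)·z) = r·τ z` (built from ★ `quadraticLocalEquiv` on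
  `E ⊗ F_v = ∏_{w ∣ v} E_w` and the single place above `v`, ★ `conjLocal_apply_eq_of_smul_eq`; stated as an `∃` so consumers carry `τ` and its three letters BY VALUE);
* §2 the phase `Ψ_s := ψ.compAddMonoidHom ((AddMonoidHom.mulLeft s).comp τ)` (a closed term, no definition): `tracePhase_apply` (`Ψ_s Z = ψ(s·τ Z)`),
  `continuous_tracePhase`, **`tracePhase_eq_of_toPlace_eq`** (`ι_{w₀} q = Z + σZ ⇒ Ψ_s Z = ψ(s·q)`), `tracePhase_mul_toPlace` (`Ψ_s(ι(r)·Z) = Ψ_{r·s}(Z)` — the unipotent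
  letter `s ↦ a⁻¹s` of `Ad(d_a)` is the argument rescaling `Z ↦ ι(a⁻¹)·Z`, cf. ★ `K2LiuLocalSWRamifiedLeviRowInvariance.forall_le_imp_comp_mul_iff`).
References: [CasselsFrohlichANT1967] Ch. II §10 (`L ⊗_K K_v ≅ ∏ L_w`), Ch. VII §1.1; [WeilBNT1967] Ch. II §5, Ch. VII §2 (characters of second degree ∕ local traces);
[Kudla1994] §3 Thm. 3.1; [MoeglinVignerasWaldspurger1987] Chap. 2 II.1 (`ψ ↦ ψ_a`).
HONEST LABEL.  Count-neutral helper; it retires nothing by itself: `HC_CM` is proved only modulo the 7 printed citations (2 remaining named inputs: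
hLiu418 = `stmt-HodgeConjecture-24832`, h413 = `stmt-HodgeConjecture-24833`) until rung 0 closes.

## References
* [CasselsFrohlichANT1967] J. W. S. Cassels, A. Fröhlich (eds.), *Algebraic Number Theory* (1967), Ch. II §10, Ch. VII §1.1.
* [WeilBNT1967] A. Weil, *Basic Number Theory* (1967), Ch. II §5, Ch. VII §2.
* [Kudla1994] S. S. Kudla, Israel J. Math. 87 (1994), §3 Thm. 3.1.
* [MoeglinVignerasWaldspurger1987] C. Mœglin, M.-F. Vignéras, J.-L. Waldspurger, LNM 1291 (1987), Chap. 2 II.1.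
-/

set_option autoImplicit false
set_option linter.dupNamespace false -- the mandated namespace repeats `HodgeConjecture.HodgeConjecture`

noncomputable section

open NumberField IsDedekindDomain
open Literature.NumberTheory.Automorphic Literature.NumberTheory.Automorphic.UnitaryGroup

namespace Summit.HodgeConjecture.HodgeConjecture.Cruxes.HLiu418.K2LiuNonsplitTracePhase

variable (F : Type) [Field F] [NumberField F] (E : Type) [Field E] [NumberField E] [Algebra F E] [Algebra.IsQuadraticExtension F E]
  (c : E ≃ₐ[F] E) (hc : c ≠ 1) {δ : E} (hcδ : c δ = -δ) (hδ : δ ≠ 0)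
  (v : HeightOneSpectrum (𝓞 F)) (w₀ : PlacesOver E v) (hw₀ : c • w₀.1 = w₀.1)

/-! ## §1 The local trace at a non-split place -/

include hc hcδ hδ hw₀ in
/-- **THE LOCAL TRACE `τ : E_{w₀} →+ F_v` AT A NON-SPLIT PLACE**: continuous, additive, with `ι_{w₀}(τ z) = z + σ_{w₀} z` and `τ(ι_{w₀}(r) · z) = r · τ z`.
Construction: `E ⊗_F F_v = F_v ⊕ F_v·δ` (★ `quadraticLocalEquiv`), `σ ⊗ 1` acts by `(a, b) ↦ (a, −b)` (★ `conjLocal_quadraticLocalEquiv`), so `Z + σZ = ι_v(2a)`; at a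
non-split `v` there is one place above `v` (★ `PlacesOver.subsingleton_of_smul_eq`) and `(σ ⊗ 1)` read at `w₀` is `σ_{w₀}` (★ `conjLocal_apply_eq_of_smul_eq`).
[cite: CasselsFrohlichANT1967, Ch. II §10] [cite: WeilBNT1967, Ch. VII §2] -/
theorem exists_localTrace :
    ∃ τ : w₀.1.adicCompletion E →+ v.adicCompletion F, Continuous τ ∧
      (∀ z, toPlace v w₀ (τ z) = z + galAdicCompletionMap (L := E) c hw₀ z) ∧
      ∀ (r : v.adicCompletion F) (z : w₀.1.adicCompletion E), τ (toPlace v w₀ r * z) = r * τ z := by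
  classical
  haveI : Subsingleton (PlacesOver E v) := PlacesOver.subsingleton_of_smul_eq c hc w₀ hw₀
  set q := quadraticLocalEquiv E v c hcδ hδ with hq
  -- the embedding `z ↦ (z)` of the `w₀`-factor as the whole of `E ⊗ F_v` (one place above `v`)
  have hsingle : ∀ (x : LocalRing E v), Pi.single w₀ (x w₀) = x := fun x => by
    funext w
    obtain rfl : w = w₀ := Subsingleton.elim w w₀
    rw [Pi.single_eq_same]
  -- the candidate: `τ z := 2 · (first coordinate of z in the basis (1, δ))`
  refine ⟨{ toFun := fun z => 2 * (q.symm (Pi.single w₀ z)).1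
            map_zero' := by rw [Pi.single_zero, map_zero, Prod.fst_zero, mul_zero]
            map_add' := fun z z' => by rw [Pi.single_add, map_add, Prod.fst_add, mul_add] }, ?_, ?_, ?_⟩
  · -- continuity
    change Continuous fun z => 2 * (q.symm (Pi.single w₀ z)).1
    have hs : Continuous fun x : w₀.1.adicCompletion E => (Pi.single w₀ x : LocalRing E v) :=
      continuous_single (A := fun w : PlacesOver E v => w.1.adicCompletion E) w₀
    exact continuous_const.mul ((continuous_fst.comp q.symm.continuous).comp hs)
  · -- `ι_{w₀}(τ z) = z + σ_{w₀} z`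
    intro z
    change toPlace v w₀ (2 * (q.symm (Pi.single w₀ z)).1) = _
    set Z : LocalRing E v := Pi.single w₀ z with hZ
    set p : v.adicCompletion F × v.adicCompletion F := q.symm Z with hp
    have hZq : Z = q (p.1, p.2) := by rw [Prod.mk.eta, hp, ContinuousLinearEquiv.apply_symm_apply]
    -- `Z + σZ = ι_v(2a)` in `E ⊗ F_v`
    have hsum : Z + conjLocal E c v Z = toLocalRing E v (2 * p.1) := by
      rw [hZq, hq, conjLocal_quadraticLocalEquiv, quadraticLocalEquiv_apply, quadraticLocalEquiv_apply, map_neg, map_mul, map_ofNat]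
      ring
    -- read at `w₀`
    have hw := congrArg (fun x : LocalRing E v => x w₀) hsum
    simp only [Pi.add_apply, toLocalRing_apply] at hw
    rw [conjLocal_apply_eq_of_smul_eq c hc v w₀ hw₀ Z] at hw
    have hZw : Z w₀ = z := by rw [hZ, Pi.single_eq_same]
    rw [hZw] at hw
    exact hw.symm
  · -- `F_v`-linearity
    intro r z
    simp only [AddMonoidHom.coe_mk, ZeroHom.coe_mk]
    have hmul : (Pi.single w₀ (toPlace v w₀ r * z) : LocalRing E v) = r • (Pi.single w₀ z : LocalRing E v) := by
      rw [Algebra.smul_def, algebraMap_localRing_eq]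
      funext w
      obtain rfl : w = w₀ := Subsingleton.elim w w₀
      rw [Pi.mul_apply, Pi.single_eq_same, Pi.single_eq_same, toLocalRing_apply]
    rw [hmul, map_smul, Prod.smul_fst, smul_eq_mul]
    ring

/-! ## §2 The phase `Ψ_s = ψ ∘ (s · τ)` -/

section Phase

variable {F E}
variable (ψ : AddChar (v.adicCompletion F) Circle) (τ : w₀.1.adicCompletion E →+ v.adicCompletion F)

omit [Algebra.IsQuadraticExtension F E] in
/-- unfolding: `Ψ_s Z = ψ(s · τ Z)`. [cite: WeilBNT1967, Ch. II §5] -/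
theorem tracePhase_apply (s : v.adicCompletion F) (Z : w₀.1.adicCompletion E) :
    ψ.compAddMonoidHom ((AddMonoidHom.mulLeft s).comp τ) Z = ψ (s * τ Z) := rfl

omit [Algebra.IsQuadraticExtension F E] in
/-- `Ψ_s` is continuous when `ψ` and `τ` are. [cite: WeilBNT1967, Ch. II §5] -/
theorem continuous_tracePhase (hψ : Continuous ψ) (hτ : Continuous τ) (s : v.adicCompletion F) :
    Continuous (ψ.compAddMonoidHom ((AddMonoidHom.mulLeft s).comp τ)) := by
  change Continuous fun Z => ψ (s * τ Z)
  exact hψ.comp (continuous_const.mul hτ)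

omit [Algebra.IsQuadraticExtension F E] in
/-- **THE BRIDGE `ψ_v(s·q) = Ψ_s(Z)` WHEN `ι_{w₀}(q) = Z + σ_{w₀} Z`** (`q` the `F_v`-valued hermitian expression of the (C3) phase, `Z = α·σβ + D·γ·σγ` the argument
★ (M2b) integrates; `ι_{w₀}` is injective). [cite: WeilBNT1967, Ch. VII §2] [cite: Kudla1994, §3 Thm. 3.1] -/
theorem tracePhase_eq_of_toPlace_eq (hτ : ∀ z, toPlace v w₀ (τ z) = z + galAdicCompletionMap (L := E) c hw₀ z)
    (s q : v.adicCompletion F) (Z : w₀.1.adicCompletion E) (hq : toPlace v w₀ q = Z + galAdicCompletionMap (L := E) c hw₀ Z) :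
    ψ.compAddMonoidHom ((AddMonoidHom.mulLeft s).comp τ) Z = ψ (s * q) := by
  have hτZ : τ Z = q := (toPlace v w₀).injective (by rw [hτ Z, hq])
  rw [tracePhase_apply, hτZ]

omit [Algebra.IsQuadraticExtension F E] in
/-- **RESCALING THE ARGUMENT BY `ι_{w₀}(r)` IS RESCALING `s`**: `Ψ_s(ι_{w₀}(r)·Z) = Ψ_{s·r}(Z)` for an `F_v`-linear `τ` — under `Ad(d_a)` the unipotent letter `s ↦ a⁻¹·s`
becomes `Z ↦ ι(a⁻¹)·Z`, a unit rescaling on balls when `|a|_{w₀} = 1` (★ `K2LiuLocalSWRamifiedLeviRowInvariance.forall_le_imp_comp_mul_iff`).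
[cite: MoeglinVignerasWaldspurger1987, Chap. 2 II.1] [cite: Kudla1994, §3 Thm. 3.1] -/
theorem tracePhase_mul_toPlace (hτr : ∀ (r : v.adicCompletion F) (z : w₀.1.adicCompletion E), τ (toPlace v w₀ r * z) = r * τ z)
    (s r : v.adicCompletion F) (Z : w₀.1.adicCompletion E) :
    ψ.compAddMonoidHom ((AddMonoidHom.mulLeft s).comp τ) (toPlace v w₀ r * Z) = ψ.compAddMonoidHom ((AddMonoidHom.mulLeft (s * r)).comp τ) Z := by
  rw [tracePhase_apply, tracePhase_apply, hτr, ← mul_assoc]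

omit [Algebra.IsQuadraticExtension F E] in
/-- **TRIVIALITY ON A BALL IS INSENSITIVE TO A UNIT RESCALING OF `s`**: if `|ι_{w₀}(r)|_{w₀} = 1` then «`Ψ_{s·r} ≡ 1` on `{v ≤ ρ}`» ⟺ «`Ψ_s ≡ 1` on `{v ≤ ρ}`» (the `Q_x`
letter of the (M2b) factorisation is `Ad(d_a)`-invariant). [cite: MoeglinVignerasWaldspurger1987, Chap. 2 II.1] [cite: Kudla1994, §3 Thm. 3.1] -/
theorem forall_tracePhase_mul_eq_one_iff (hτr : ∀ (r : v.adicCompletion F) (z : w₀.1.adicCompletion E), τ (toPlace v w₀ r * z) = r * τ z)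
    (s : v.adicCompletion F) {r : v.adicCompletion F} (hr : Valued.v (toPlace v w₀ r) = 1) (ρ : WithZero (Multiplicative ℤ)) :
    (∀ Z : w₀.1.adicCompletion E, Valued.v Z ≤ ρ → ψ.compAddMonoidHom ((AddMonoidHom.mulLeft (s * r)).comp τ) Z = 1) ↔
      (∀ Z : w₀.1.adicCompletion E, Valued.v Z ≤ ρ → ψ.compAddMonoidHom ((AddMonoidHom.mulLeft s).comp τ) Z = 1) := by
  have hr0 : toPlace v w₀ r ≠ 0 := fun h => by rw [h, map_zero] at hr; exact zero_ne_one hr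
  constructor
  · intro h Z hZ
    have h' := h ((toPlace v w₀ r)⁻¹ * Z) (by rw [map_mul, map_inv₀, hr, inv_one, one_mul]; exact hZ)
    rwa [← tracePhase_mul_toPlace v w₀ ψ τ hτr, ← mul_assoc, mul_inv_cancel₀ hr0, one_mul] at h'
  · intro h Z hZ
    rw [← tracePhase_mul_toPlace v w₀ ψ τ hτr]
    exact h _ (by rw [map_mul, hr, one_mul]; exact hZ)

end Phase

end Summit.HodgeConjecture.HodgeConjecture.Cruxes.HLiu418.K2LiuNonsplitTracePhase

end
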